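import Summits.Ventures.QEDPrecision.Diagrams.VolkovClasses

/-!
Venture QEDPrecision / cell `pub-qed`, unit `pub-qed-diag-2` (DIAG-2, gen 8). HONEST FRAMING: independent recomputation;
certified where stated, statistical where stated; no new-physics claim.  NEW WORK of the cell (a kernel-checked census), not a
published result: nothing here is cited as a fact anywhere; the printed sources are named only in comments.
Staged copy: HOME/lean/diag2/VolkovForests.lean (HOME = run/shared/lean/pub/pub-qed/; declarations byte-identical).

# Kernel-checked census of Volkov's UV-divergent subgraphs and forests, QED vertex graphs without lepton loops, orders 2–8

Volkov's subtraction procedure [arXiv:1705.05800 §2; arXiv:1807.05281 §2; arXiv:1909.08015 §2] assigns to every vertex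
graph `G` the forest formula `Σ_{F ∈ 𝔉[G]} (-1)^{|F|-1} (operators)`, where `𝔉[G]` is the set of FORESTS: sets of
UV-divergent subgraphs of `G` containing `G` itself, any two members of which are nested or non-intersecting; in QED the
UV-divergent subgraphs are the one-particle-irreducible electron-self-energy-like and vertex-like subgraphs (for graphs
without lepton loops there are no photon-self-energy or light-by-light subgraphs).

Model (that of `NoLoopVertexGraphs`: path points `0 … 2n`, external vertex `X` = the unmatched point, photons = pairs
`(a, b)`, `a < b`).  A subgraph with two external electron legs of a graph whose only lepton line is the open path is
spanned by a SEGMENT of consecutive path vertices `i … j`, `i < j`, with all photons having both ends in the segment; its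
photon legs are the internal photons with exactly one end in the segment plus the external photon when `X ∈ [i, j]`
(`segPhotonLegs`); it is one-particle irreducible iff each electron line `(k, k+1)`, `i ≤ k < j`, is bridged by a photon
with both ends in the segment (`segIrreducible`).  `uvSegments` = the segments that are irreducible with ≤ 1 photon leg
(0: self-energy-like, 1: vertex-like); `properUV` = all but the whole graph; a forest is `{G} ∪ F` with `F` a pairwise
compatible (nested or disjoint, `segCompatible`) subfamily of `properUV`, counted by `forestCount`.

Certified here by kernel `decide` (no `native_decide`, no axioms), over Volkov's UNDIRECTED graphs (canonical orbit
representatives, 1/4/28/269 of them) and over the DIRECTED graphs (1/6/50/518), for n = 1, 2, 3, 4 internal photons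
(orders e², e⁴, e⁶, e⁸) — `forestCensus n = [#graphs, Σ proper self-energy-like, Σ proper vertex-like, Σ |𝔉[G]|,
max |𝔉[G]|, Σ overlapping proper pairs, Σ proper pairs meeting in exactly one vertex, #graphs whose whole segment is a
vertex-like UV subgraph]`:
* undirected: `[1,0,0,1,1,0,0,1]`, `[4,1,2,7,2,0,0,4]`, `[28,15,27,88,6,1,0,28]`, `[269,188,352,1368,16,21,0,269]`;
* directed:   `[1,0,0,1,1,0,0,1]`, `[6,2,3,11,2,0,0,6]`, `[50,28,48,159,6,2,0,50]`, `[518,368,680,2657,16,42,0,518]`;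
* the histogram of `|𝔉[G]|` over the undirected graphs at orders e⁶ and e⁸.
So: proper UV-divergent subgraphs 0/3/42/540 and forests 1/7/88/1368 over the undirected graphs — the numbers on which the
cell's three forest generators agree graph by graph (HOME/pub-qed-diag-2/XCHECK.md §X-A: int-2's generator, diag-2's
`vforest.py`, and diag-1's independent re-implementation, DIFF-LOG.md Gen 7/8); the whole graph is always a vertex-like
UV-divergent subgraph (so `𝔉[G]` is never empty); and NO two proper UV-divergent segments ever meet in exactly one path
vertex, so reading "non-intersecting" on vertex sets or on line sets gives the same forests for all these graphs (the
overlapping pairs — neither nested nor disjoint, e.g. the two crossed vertex subgraphs of `(0,6),(2,4),(3,5)` — share an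
electron line and are excluded under either reading).  The order-e¹⁰ census (3213 graphs: 7550 proper UV-divergent subgraphs, 24608 forests) is in `VolkovForestsOrder10`.
-/

namespace Summit.Ventures.QEDPrecision.Diagrams

/-- the path point `p` lies in the segment `[i, j]`. -/
def inSeg (i j p : ℕ) : Bool := Nat.ble i p && Nat.ble p j

/-- one pass over the photons of `M` for the segment `[i, j]`: `(number of photons with exactly one end in the segment,
the photons with both ends in it)`. -/
def segScan (i j : ℕ) : List (ℕ × ℕ) → ℕ × List (ℕ × ℕ)
  | [] => (0, [])
  | e :: t =>
      match inSeg i j e.1, inSeg i j e.2 with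
      | true, true => ((segScan i j t).1, e :: (segScan i j t).2)
      | false, false => segScan i j t
      | _, _ => ((segScan i j t).1 + 1, (segScan i j t).2)

/-- photon legs of the subgraph spanned by the segment `[i, j]` of a vertex graph with external vertex `X`:
internal photons with exactly one end in the segment, plus the external photon when `X ∈ [i, j]`. -/
def segPhotonLegs (X i j : ℕ) (M : List (ℕ × ℕ)) : ℕ :=
  (segScan i j M).1 + (inSeg i j X).toNat

/-- every electron line `(k, k+1)` for `k = k₀, …, k₀ + f - 1` is bridged by one of the photons `inner`. -/
def allBridged (inner : List (ℕ × ℕ)) : ℕ → ℕ → Bool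
  | _, 0 => true
  | k, f + 1 => inner.any (fun e => Nat.ble e.1 k && Nat.blt k e.2) && allBridged inner (k + 1) f

/-- one-particle irreducibility of the subgraph spanned by `[i, j]`: each of its electron lines `(k, k+1)`,
`i ≤ k < j`, is bridged by a photon with BOTH ends in the segment. -/
def segIrreducible (i j : ℕ) (M : List (ℕ × ℕ)) : Bool :=
  allBridged (segScan i j M).2 i (j - i)

/-- the segment `[i, j]` spans a UV-divergent subgraph: at most one photon leg, and one-particle irreducible. -/
def isUVSegment (X i j : ℕ) (M : List (ℕ × ℕ)) : Bool :=
  let sc := segScan i j M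
  Nat.ble (sc.1 + (inSeg i j X).toNat) 1 && allBridged sc.2 i (j - i)

/-- Volkov's UV-divergent subgraphs of a vertex graph WITHOUT lepton loops on the path points `0 … N-1` with external
vertex `X`, as segments `(i, j)`, `i < j`: the subgraph spanned by the consecutive path vertices `i … j` is one-particle
irreducible and has at most ONE photon leg (0: electron-self-energy-like, 1: vertex-like).  The whole graph `(0, N-1)`
is included (it is vertex-like for every 1PI vertex graph: `forestCensus_*`, last component). -/
def uvSegments (N X : ℕ) (M : List (ℕ × ℕ)) : List (ℕ × ℕ) :=
  (List.range N).foldr (fun i acc =>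
    ((List.range (N - 1 - i)).foldr (fun t acc' => if isUVSegment X i (i + 1 + t) M then (i, i + 1 + t) :: acc' else acc') [])
      ++ acc) []

/-- the PROPER UV-divergent subgraphs: all but the whole graph `(0, N-1)`. -/
def properUV (N X : ℕ) (M : List (ℕ × ℕ)) : List (ℕ × ℕ) :=
  (uvSegments N X M).filter (fun s => !(s.1 == 0 && s.2 == N - 1))

/-- two segments are compatible members of one forest: nested or disjoint. -/
def segCompatible (s t : ℕ × ℕ) : Bool :=
  (Nat.ble s.1 t.1 && Nat.ble t.2 s.2) || (Nat.ble t.1 s.1 && Nat.ble s.2 t.2) || Nat.blt s.2 t.1 || Nat.blt t.2 s.1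

/-- two segments (each written `(i, j)` with `i < j`) meet in exactly one path vertex. -/
def segTouch (s t : ℕ × ℕ) : Bool := s.2 == t.1 || t.2 == s.1

/-- number of sub-families of `l` that are pairwise compatible and compatible with every member of `chosen`
(structural recursion on `l`); with `chosen = []` and `l = properUV …` this is `|𝔉[G]|`, the number of Volkov forests
(each forest being `{G} ∪` such a sub-family, since `G` is compatible with everything). -/
def forestCount : List (ℕ × ℕ) → List (ℕ × ℕ) → ℕ
  | [], _ => 1
  | s :: t, chosen => forestCount t chosen + (if chosen.all (segCompatible s) then forestCount t (s :: chosen) else 0)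

/-- number of unordered pairs `{s, t}` of a list (in list order `s` before `t`) with `r s t`. -/
def pairCount (r : ℕ × ℕ → ℕ × ℕ → Bool) : List (ℕ × ℕ) → ℕ
  | [] => 0
  | s :: t => (t.filter (r s)).length + pairCount r t

/-- per-graph forest data of a vertex graph with `n` internal photons: `(#proper self-energy-like UV subgraphs,
#proper vertex-like UV subgraphs, |𝔉[G]|, #overlapping proper pairs (neither nested nor disjoint), #proper pairs meeting
in exactly one vertex, the whole graph is a vertex-like UV segment)`. -/
def forestData (n : ℕ) (M : List (ℕ × ℕ)) : ℕ × ℕ × ℕ × ℕ × ℕ × Bool :=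
  let N := 2 * n + 1
  let X := extVertex N M
  let U := uvSegments N X M
  let P := U.filter (fun s => !(s.1 == 0 && s.2 == N - 1))
  let se := (P.filter (fun s => segPhotonLegs X s.1 s.2 M == 0)).length
  (se, P.length - se, forestCount P [], pairCount (fun s t => !segCompatible s t) P, pairCount segTouch P,
   U.contains (0, N - 1) && segPhotonLegs X 0 (N - 1) M == 1)

/-- census row over a list of graphs with `n` internal photons, accumulated as a nested pair and reported as the list
`[#graphs, Σ proper self-energy-like, Σ proper vertex-like, Σ |𝔉[G]|, max |𝔉[G]|, Σ overlapping proper pairs,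
Σ one-vertex contacts, #graphs whose whole segment is a vertex-like UV subgraph]`. -/
def censusRow (n : ℕ) (L : List (List (ℕ × ℕ))) : List ℕ :=
  let r := L.foldl (fun (acc : ℕ × ℕ × ℕ × ℕ × ℕ × ℕ × ℕ × ℕ) M =>
    let d := forestData n M
    (acc.1 + 1, acc.2.1 + d.1, acc.2.2.1 + d.2.1, acc.2.2.2.1 + d.2.2.1, max acc.2.2.2.2.1 d.2.2.1,
     acc.2.2.2.2.2.1 + d.2.2.2.1, acc.2.2.2.2.2.2.1 + d.2.2.2.2.1, acc.2.2.2.2.2.2.2 + d.2.2.2.2.2.toNat))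
    (0, 0, 0, 0, 0, 0, 0, 0)
  [r.1, r.2.1, r.2.2.1, r.2.2.2.1, r.2.2.2.2.1, r.2.2.2.2.2.1, r.2.2.2.2.2.2.1, r.2.2.2.2.2.2.2]

/-- the forest census over Volkov's UNDIRECTED vertex graphs without lepton loops with `n` internal photons (canonical
representatives of the path-reversal orbits, as in `NoLoopVertexGraphs.vertexUndirected`). -/
def forestCensus (n : ℕ) : List ℕ :=
  censusRow n ((vertexGraphs n).filter (isCanonical (2 * n + 1)))

/-- the same census over the DIRECTED vertex graphs (AHKN's counting, `NoLoopVertexGraphs.vertexDirected`). -/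
def forestCensusDirected (n : ℕ) : List ℕ :=
  censusRow n (vertexGraphs n)

/-- insert one observation `f` into a histogram kept as a sorted list `(value, multiplicity)`. -/
def bumpHist (f : ℕ) : List (ℕ × ℕ) → List (ℕ × ℕ)
  | [] => [(f, 1)]
  | (g, c) :: t => if g == f then (g, c + 1) :: t else if Nat.blt f g then (f, 1) :: (g, c) :: t else (g, c) :: bumpHist f t

/-- histogram of `|𝔉[G]|` over the undirected vertex graphs without lepton loops with `n` internal photons. -/
def forestHistogram (n : ℕ) : List (ℕ × ℕ) :=
  ((vertexGraphs n).filter (isCanonical (2 * n + 1))).foldl (fun acc M => bumpHist (forestData n M).2.2.1 acc) []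

/-! ## order e⁴ explicitly -/

/-- order e⁴, the six directed graphs of `order4_explicit` with their external vertex and UV-divergent segments: the two
graphs with a vertex insertion `(0,4),(1,3)` / its mirror have the proper vertex-like segment `(1,3)`; the self-energy
insertions `(2,3)`, `(1,2)` and (mirror) `(2,4)`… are proper self-energy-like segments; the crossed graph `(0,3),(1,4)`
and its class partner have none. -/
theorem order4_uvSegments :
    (vertexGraphs 2).map (fun M => (M, extVertex 5 M, uvSegments 5 (extVertex 5 M) M)) =
      [([(0, 3), (2, 4)], 1, [(0, 4), (2, 4)]), ([(0, 4), (2, 3)], 1, [(0, 4), (2, 3)]), ([(0, 3), (1, 4)], 2, [(0, 4)]),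
       ([(0, 4), (1, 3)], 2, [(0, 4), (1, 3)]), ([(0, 2), (1, 4)], 3, [(0, 2), (0, 4)]),
       ([(0, 4), (1, 2)], 3, [(0, 4), (1, 2)])] := by
  decide +kernel

/-! ## the census, orders e², e⁴, e⁶, e⁸ -/

/-- orders e², e⁴, e⁶ over the undirected graphs (1, 4, 28 graphs): proper UV subgraphs 0, 1+2, 15+27; forests 1, 7, 88;
max forests per graph 1, 2, 6; overlapping pairs 0, 0, 1; one-vertex contacts 0; whole graph vertex-like always. -/
theorem forestCensus_orders_2_4_6 :
    forestCensus 1 = [1, 0, 0, 1, 1, 0, 0, 1] ∧ forestCensus 2 = [4, 1, 2, 7, 2, 0, 0, 4] ∧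
      forestCensus 3 = [28, 15, 27, 88, 6, 1, 0, 28] := by
  refine ⟨?_, ?_, ?_⟩ <;> decide +kernel

set_option maxRecDepth 20000 in
/-- order e⁸ over the 269 undirected graphs: proper UV subgraphs 188 self-energy-like + 352 vertex-like = 540; forests 1368
(max 16 in one graph); 21 overlapping proper pairs; 0 one-vertex contacts; the whole graph is vertex-like for all 269. -/
theorem forestCensus_order8 : forestCensus 4 = [269, 188, 352, 1368, 16, 21, 0, 269] := by
  decide +kernel

/-- orders e², e⁴, e⁶ over the directed graphs (1, 6, 50 graphs): forests 1, 11, 159. -/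
theorem forestCensusDirected_orders_2_4_6 :
    forestCensusDirected 1 = [1, 0, 0, 1, 1, 0, 0, 1] ∧ forestCensusDirected 2 = [6, 2, 3, 11, 2, 0, 0, 6] ∧
      forestCensusDirected 3 = [50, 28, 48, 159, 6, 2, 0, 50] := by
  refine ⟨?_, ?_, ?_⟩ <;> decide +kernel

set_option maxRecDepth 20000 in
/-- order e⁸ over the 518 directed graphs: proper UV subgraphs 368 + 680 = 1048; forests 2657; 42 overlapping pairs;
0 one-vertex contacts; whole graph vertex-like for all 518. -/
theorem forestCensusDirected_order8 : forestCensusDirected 4 = [518, 368, 680, 2657, 16, 42, 0, 518] := by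
  decide +kernel

/-- histograms of `|𝔉[G]|` over the undirected graphs: order e⁶ `1 ↦ 4, 2 ↦ 7, 4 ↦ 16, 6 ↦ 1` (28 graphs, 88 forests);
order e⁸ `1 ↦ 34, 2 ↦ 60, 4 ↦ 62, 6 ↦ 3, 8 ↦ 94, 12 ↦ 15, 16 ↦ 1` (269 graphs, 1368 forests). -/
theorem forestHistogram_orders_6_8 :
    forestHistogram 3 = [(1, 4), (2, 7), (4, 16), (6, 1)] ∧
      forestHistogram 4 = [(1, 34), (2, 60), (4, 62), (6, 3), (8, 94), (12, 15), (16, 1)] := by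
  refine ⟨?_, ?_⟩ <;> decide +kernel

/-! ## consistency on the numerals -/

/-- the graph counts of the census (first entries) are the totals of `NoLoopVertexGraphs` (undirected 1/4/28/269, directed
1/6/50/518), and the two histograms have the certified numbers of graphs (28, 269) and of forests (88, 1368) as moments. -/
theorem forestCensus_consistency :
    ((forestCensus 1).headD 0 = vertexUndirected 1 ∧ (forestCensus 2).headD 0 = vertexUndirected 2 ∧
      (forestCensus 3).headD 0 = vertexUndirected 3 ∧ (forestCensus 4).headD 0 = vertexUndirected 4) ∧
    ((forestCensusDirected 1).headD 0 = vertexDirected 1 ∧ (forestCensusDirected 2).headD 0 = vertexDirected 2 ∧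
      (forestCensusDirected 3).headD 0 = vertexDirected 3 ∧ (forestCensusDirected 4).headD 0 = vertexDirected 4) ∧
    (((forestHistogram 3).map (fun p => p.2)).sum = 28 ∧ ((forestHistogram 3).map (fun p => p.1 * p.2)).sum = 88) ∧
    (((forestHistogram 4).map (fun p => p.2)).sum = 269 ∧ ((forestHistogram 4).map (fun p => p.1 * p.2)).sum = 1368) := by
  obtain ⟨h1, h2, h3⟩ := forestCensus_orders_2_4_6
  obtain ⟨d1, d2, d3⟩ := forestCensusDirected_orders_2_4_6
  obtain ⟨u1, u2, u3, u4⟩ := vertexUndirected_values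
  obtain ⟨v1, v2, v3, v4⟩ := vertexDirected_values
  obtain ⟨g3, g4⟩ := forestHistogram_orders_6_8
  rw [h1, h2, h3, forestCensus_order8, d1, d2, d3, forestCensusDirected_order8, u1, u2, u3, u4, v1, v2, v3, v4, g3, g4]
  decide

end Summit.Ventures.QEDPrecision.Diagrams
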